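import Summits.QuantumFields.YangMills.Theorems.UnitScaleTiltProp7SectET3DeltaOneT3PInvGlue
import Summits.QuantumFields.YangMills.Theorems.UnitScaleTiltProp7ActionGradCurrentT3
import Summits.QuantumFields.YangMills.Theorems.UnitScaleTiltProp7HDsolAtRecordOfRows
import Summits.QuantumFields.YangMills.Theorems.UnitScaleTiltProp7SigmaRowsNorm
import HarnessLib

/-!
# «TJ-ROW DOOR» — the EX display's operator row `hTJ` (the sup-row of print's J-term operator `T_Jᴾ(U₀)`, [Balaban1985BackgroundPropagators] (3.127)–(3.128) ∕ (3.137)) IS A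
# COROLLARY OF TWO ROWS THE DISPLAY ALREADY CARRIES — `hHcol` (the `ℓ¹`-column of print's `H` (3.126)) and `hC157` ([Balaban1985Averaging] Prop. 5 (157) for the chart of record) —
# by duality, the current row (28) (a THEOREM at `U₀ ∈ 𝔘_k(ρ)`), ★px18's `2d = 6` coarse-column count, and one limit; def-free, NO new displayed row

Cell `ym3-torus` (HUMAN RULING D-0037, YM ladder rung R3 — YM₃ on T³, NOT d = 4, NOT Clay; YM gap NOT proved), width seat `ym3-torus-px13` (gen 5, explicit-unit helper; EX namer
★w2-19200 g7 02:27:32Z «NEXT DOORS WANTED … the six operator rows»).  THEOREMS ONLY (0 `def`, 0 `sorry`); `--supports stmt-QuantumFields-19200 --as helper`, count-neutral; NO claim on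
crux ∕ stub ∕ registry.  Route `UnitScaleTilt`, crux «MinimiserStabilityRegPr» (stmt-QuantumFields-19200), stub `stub_existenceMinimalOrbit` (EX), display of record S20ᴸ ✓p690345 (rows
`hHcol` :143–146, `hC157` :148–151, `hTJ` :212–214; S19ᴸ ✓p688733 has the same `hHcol`∕`hTJ` texts).

THE PRINT.  [Balaban1985BackgroundPropagators] p. 421 (3.127): «⟨A, Δ₁A⟩ = ⟨A, ΔA⟩ − 2⟨HC⁽²⁾(A), J⟩ … they are small because the configuration J is small»; p. 423 (3.137): «|(Δ⁽²⁾A)(b)| ≤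
O(1)Mα₀(Lʲη)⁻²|A|»; (3.11)–(3.12) p. 392 (`⟨A, J⟩`, `J = D*η⁻²Im ∂U`); (3.14) p. 393 («C_j(U, A) is an analytic function of A whose expansion begins with second order terms»);
(3.126) p. 420 (`H = GQ*(QGQ*)⁻¹`).  [Balaban1985Variational] (27)–(28) p. 282 (`⟨A, J⟩ = Σ_b η^d tr A(b)J(b)`, `|J| ≤ C₁B₃ε₁`); (72)–(73) p. 289.  [Balaban1985Averaging] Prop. 5 (157) p. 42.

THE MATHEMATICS (duality + calculus over the landed letters; no propagator theory).  By ✓`inner_TJP_left` ∕ ✓`tjSesqP_apply` ∕ ✓`tjFormP_apply`,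
`⟪T_Jᴾ(toL2 X), toL2 X′⟫ = (−2c₀∕η²)·t_Jᴾ[Xᴴ, X′] = (2c₀∕η²)·actionGrad U₀ (H46P U₀ (avgHess U₀ Xᴴ X′))`, and by ✓`inner_toL2` `⟪toL2 Y, toL2 (δ_bd·A)⟫ = c₀·tr((Y bd)ᴴA)`.  Testing
`Y := toL2⁻¹ T_Jᴾ toL2 X` against `X′ := δ_bd·(Y bd)` gives `⟪toL2 Y, w⟫ = ‖w‖²` (`w := toL2 (δ_bd·Y bd)`), and `c₀‖Y bd‖² ≤ ‖w‖²` (✓`c0_mul_sum_norm_sq_le_norm_sq_toL2`, operator ≤ Hilbert–Schmidt).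
Hence, from three column rows (J) `‖actionGrad U₀ Z‖ ≤ cJ·Σ_b‖Z b‖`, (H) `Σ_b‖H46P U₀ B b‖ ≤ θ·Σ_y‖B y‖`, (q) `Σ_y‖avgHess U₀ X′ (δ_bd·E) y‖ ≤ q·sup‖X′‖·‖E‖`:
**`‖(toL2⁻¹ T_Jᴾ toL2 X) bd‖ ≤ (2∕η²)·cJ·θ·q·s`** (§2).  (J) is a THEOREM at `U₀ ∈ 𝔘_k(ρ)` with `cJ := η³ρ` (§1: ✓`actionGrad_eq_inner_toL2_Jcur` + lit ✓`norm_Jcur_le` ∘ ✓`inU2cur_bgOfCfg_of_regPr`);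
(H) follows from the display's `hHcol` with `θ := η·ΘH·(L^{K−n})³` (§1: `H46P = Hf∘Δ_πᴾ = η•toL2⁻¹∘HT∘toL2B` reads the SAME `HT` as `flat115 ∘ H1f`, ✓`Hf_apply`∕✓`H1f_apply`); (q) follows from the
display's `hC157` with `q := 6·g·(L^{K−n})⁻¹` (§4: `avgHess = D²(log U̿^{twS})(0)` by ✓`avgHess_def`; on the ball `B(0, e·η)` of W5 ✓`analyticOnNhd_logChartTwS`, `fderiv (log U̿)(B) − Q(U₀) =
fderiv C(U₀,·)(B)` (✓`CmapTwS_apply`, ✓`QTwS_def`); the `δ_bd`-column of `fderiv C(B)` is `≤ 6·(g·(L^{K−n})⁻¹·‖B‖·‖δ‖)` by ★px18 ✓`sum_norm_fderiv_CmapTwS_apply_le_of_entry_row` fed with `hC157`'s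
entries; a second derivative at `0` inherits a first-derivative column bound `≤ m·‖B‖` near `0` — difference quotients along `t ↦ t•X′`, `HasDerivAt.tendsto_slope_zero`, `le_of_tendsto`).
DIMENSION LINE: `kTJ = (2∕η²)·(η³·α)·(η·ΘH·(L^{K−n})³)·(6·g·(L^{K−n})⁻¹) = 12·α·ΘH·g` since `L^{K−n}·η = 1` — L-only.

WHAT IS PROVED (ns `…Theorems.Prop7TJRowOfColumns`; member `F`, `h : n ≤ K`, weights `c₀ cB a`, background `U₀`):
* §1 `norm_star_apply_le` (‖Xᴴ b‖ ≤ s), `norm_trace_mul_le` (`|tr(XY)| ≤ 2‖X‖‖Y‖`), ★`norm_actionGrad_le_of_regPr` ((J) at `RegPr ρ U₀`: `‖actionGrad U₀ Z‖ ≤ η³·ρ·Σ_b‖Z b‖`), `H46P_apply_eq_smul_flat115`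
  (`H46P B bd = η • flat115 (H1f … Δ_πᴾ U₀ B) (bondEquiv bd)`), ★`sum_norm_H46P_le_of_column` ((H) from an `hHcol`-shaped column majorant).
* §2 ★★`norm_TJP_apply_le_of_columns` — the member door from (J)(H)(q), constant `(2∕η²)·cJ·θ·q`; ★★`tjRow_of_regPr_column` — at `RegPr ρ U₀` from `hHcol`'s majorant and (q), constant `2·ρ·Θ·q·η²`.
* §3 ★★`hTJ_of_hHcol_hq` — family door: S20ᴸ's `hTJ` TOKEN FOR TOKEN with `kTJ L := 2·α L·ΘH L·qA L`, from `hHcol` VERBATIM and a local-Hessian column row `hq` (supplier currency `qA·(L^{K−n})⁻¹`).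
* SEQUEL FILE `UnitScaleTiltProp7TJRowOfEntry157` (§4–§5): the row `hq` FROM the display's `hC157` (`qA := 6·g`) and ★★★`hTJ_of_hHcol_h157` — S20ᴸ's `hTJ` from `hHcol` ∧ `hC157` VERBATIM,
  `kTJ L := 12·α L·ΘH L·g L`, NO new displayed row.
HONEST SCOPE.  Norm∕calculus bookkeeping over landed identities; the content rows `hHcol` ([B9] Thm 3.12 (3.133) class, N06) and `hC157` ([B8] Prop. 5 (157) class) stay DISPLAYED, not proved;
nothing of the stub, the crux, d = 4 or the mass gap is claimed.

References: T. Bałaban, CMP **99** (1985) 389–434 [Balaban1985BackgroundPropagators] ((3.11)–(3.14) pp.392–393, (3.126)–(3.128) pp.420–421, (3.133) p.422, (3.137) p.423);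
CMP **102** (1985) 277–309 [Balaban1985Variational] ((14) p.280, (27)–(28) p.282, (72)–(73) p.289, (115) p.294); CMP **98** (1985) 17–51 [Balaban1985Averaging] ((110) p.34, Prop. 5 (157) p.42).
-/

set_option autoImplicit false

noncomputable section

open scoped InnerProductSpace ComplexConjugate Matrix.Norms.L2Operator BigOperators Matrix
open Complex (I)

namespace Summit.QuantumFields.YangMills.Theorems.Prop7TJRowOfColumns

open Literature.MathematicalPhysics.QuantumFieldTheory.Balaban1983to89
open Literature.MathematicalPhysics.QuantumFieldTheory.Balaban1983to89.T3ContinuumYM3Torus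
open Literature.MathematicalPhysics.QuantumFieldTheory.Balaban1983to89.T3Thm1Carrier (Idx)
open T3SectALandauChart (eta eta_pos)
open T3PrintedRegularMinimiser (RegPr)
open B9SectCLatticeCarrier (Bond)
open B9Eq311L2Pairing (WL2)
open B11Eq115Space (NegSize NegSup Space115 JetSup levWeight)
open B11Eq111FrakG (nabla115)
open B11Eq103H1Complex (SiteL2K BondL2K funEquiv funEquiv_symm_apply)
open B11Eq98CurrentSlot (Jcur norm_Jcur_le)
open B11Eq90V0primeCurrent (flat115 flat115_apply)
open Summit.QuantumFields.YangMills.Theorems.Prop7SectET3Transport (periodsT3 bondEquiv bgOfCfg isUnitaryBg_bgOfCfg)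
open Summit.QuantumFields.YangMills.Theorems.Prop7SectET3HilbertLetters (W₂ frobEquiv toL2 toL2B inner_toL2 toL2_symm_apply)
open Summit.QuantumFields.YangMills.Theorems.Prop7SectET3CurvedPropagators (HT Hf H1f Hf_apply H1f_apply)
open Summit.QuantumFields.YangMills.Theorems.Prop7SectET3DeltaPiPInv (DeltaPiSlotP H46P)
open Summit.QuantumFields.YangMills.Theorems.Prop7SectET3DeltaOne (actionGrad avgHess)
open Summit.QuantumFields.YangMills.Theorems.Prop7SectET3DeltaOnePInv (TJP TJSlotP tjFormP_apply tjSesqP_apply inner_TJP_left TJSlotP_apply)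
open Summit.QuantumFields.YangMills.Theorems.Prop7ActionGradCurrent (actionGrad_eq_inner_toL2_Jcur)
open Summit.QuantumFields.YangMills.Theorems.Prop7SectET3Objects (inU2cur_bgOfCfg_of_regPr)
open Summit.QuantumFields.YangMills.Theorems.Prop7HDsolAtRecordOfRows (toL2_symm_funEquiv_symm_apply norm_negSup_equiv_apply_le)
open Summit.QuantumFields.YangMills.Theorems.Prop7SigmaRowsNorm (c0_mul_sum_norm_sq_le_norm_sq_toL2)

variable {F : T3Family} {n K : ℕ} {h : n ≤ K} {c₀ cB a : ℝ} [Fact (0 < c₀)] [Fact (0 < cB)]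

/-! ## §1 The three supplier letters: `Xᴴ`, the current row (J) at `RegPr`, and `H46P` read through `flat115 ∘ H1f` -/

/-- `‖Xᴴ(b)‖ = ‖X(b)‖` bondwise in the `L²`-operator norm, hence a sup bound passes to `star X`. [folklore] -/
theorem norm_star_apply_le {X : PBond (F.P K) 0 → Matrix (Fin 2) (Fin 2) ℂ} {s : ℝ} (hX : ∀ b, ‖X b‖ ≤ s) (b : PBond (F.P K) 0) :
    ‖(star X) b‖ ≤ s := by
  rw [Pi.star_apply, Matrix.star_eq_conjTranspose, Matrix.l2_opNorm_conjTranspose]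
  exact hX b

/-- `|tr(X·Y)| ≤ 2‖X‖‖Y‖` for `2×2` matrices in the operator norm (lit ✓`MatrixNorms.norm_ntr_le_opNorm` + submultiplicativity). [folklore] -/
theorem norm_trace_mul_le (X Y : Matrix (Fin 2) (Fin 2) ℂ) : ‖Matrix.trace (X * Y)‖ ≤ 2 * (‖X‖ * ‖Y‖) := by
  -- lit ✓`MatrixNorms.norm_ntr_le_opNorm`: `‖tr M ∕ 2‖ ≤ ‖M‖`, then submultiplicativity
  have h := MatrixNorms.norm_ntr_le_opNorm (X * Y)
  rw [MatrixNorms.ntr, Fintype.card_fin, norm_div, Complex.norm_natCast, div_le_iff₀ (by norm_num : (0 : ℝ) < (2 : ℕ))] at h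
  calc ‖Matrix.trace (X * Y)‖ ≤ ‖X * Y‖ * ((2 : ℕ) : ℝ) := h
    _ ≤ ‖X‖ * ‖Y‖ * ((2 : ℕ) : ℝ) := mul_le_mul_of_nonneg_right (Matrix.l2_opNorm_mul X Y) (by norm_num)
    _ = 2 * (‖X‖ * ‖Y‖) := by push_cast; ring

/-- ★ **(J) — THE CURRENT ROW AT `U₀ ∈ 𝔘_k(ρ)`, A THEOREM: `‖actionGrad U₀ Z‖ ≤ η³·ρ·Σ_b ‖Z b‖`** for EVERY exponent field `Z`: [Balaban1985Variational] (27) in the `L²` letters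
(✓`actionGrad_eq_inner_toL2_Jcur`: `actionGrad U₀ Z = −(iη³∕(2c₀))·⟪toL2 Zᴴ, Ĵ⟫`) with (28) `‖J‖₍₋₃₎ ≤ ρ` (lit ✓`norm_Jcur_le` on the current clause ✓`inU2cur_bgOfCfg_of_regPr` of `RegPr ρ U₀`)
and `|tr(Z(b)J(b))| ≤ 2‖Z(b)‖‖J(b)‖`. [cite: Balaban1985Variational, (27)–(28) p.282, (14) p.280; Balaban1985BackgroundPropagators, (3.11)–(3.12) p.392] -/
theorem norm_actionGrad_le_of_regPr [Fact (0 < (F.L : ℝ))] [Fact (0 < ((F.L : ℝ)⁻¹) ^ (K - n))] {ρ : ℝ} (hρ : 0 ≤ ρ)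
    (U₀ : GaugeField (F.P K) 0 (Matrix.specialUnitaryGroup (Fin 2) ℂ)) (hreg : RegPr F n K ρ U₀) (Z : PBond (F.P K) 0 → Matrix (Fin 2) (Fin 2) ℂ) :
    ‖actionGrad F K U₀ Z‖ ≤ (((F.L : ℝ)⁻¹) ^ (K - n)) ^ 3 * ρ * ∑ b : PBond (F.P K) 0, ‖Z b‖ := by
  -- `actionGrad` is weight-free: read (27) in the `L²` letters at the weight `c₀ := 1`
  haveI h1 : Fact ((0 : ℝ) < 1) := ⟨one_pos⟩
  have hc₀ : (0 : ℝ) < (1 : ℝ) := one_pos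
  have hηpos : (0 : ℝ) < ((F.L : ℝ)⁻¹) ^ (K - n) := Fact.out
  -- (28): `‖J‖₍₋₃₎ ≤ ρ` at the background of record
  have hJ : ‖Jcur (L := (F.L : ℝ)) (η := ((F.L : ℝ)⁻¹) ^ (K - n)) (lev₀ := fun _ : Bond 3 (periodsT3 F K) => K - n) (bgOfCfg F K U₀)‖ ≤ 1 * 1 * ρ :=
    norm_Jcur_le (L := (F.L : ℝ)) (η := ((F.L : ℝ)⁻¹) ^ (K - n)) (lev₀ := fun _ : Bond 3 (periodsT3 F K) => K - n) _ (isUnitaryBg_bgOfCfg F K U₀)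
      (by positivity) (fun b => by simpa only [one_mul] using inU2cur_bgOfCfg_of_regPr (F := F) (K := K) n U₀ hreg b)
  rw [one_mul, one_mul] at hJ
  -- the `L²` vector `Ĵ` read back on the route carrier
  set g : Bond 3 (periodsT3 F K) → Matrix (Fin 2) (Fin 2) ℂ :=
    NegSup.equiv _ _ (Jcur (bgOfCfg F K U₀) : NegSize (F.L : ℝ) (((F.L : ℝ)⁻¹) ^ (K - n)) (fun _ : Bond 3 (periodsT3 F K) => K - n) 3 (Matrix (Fin 2) (Fin 2) ℂ)) with hgdef
  set Jv : PBond (F.P K) 0 → Matrix (Fin 2) (Fin 2) ℂ := fun bd => g (bondEquiv F K bd) with hJvdef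
  have hJhat : (funEquiv frobEquiv (fun _ : Bond 3 (periodsT3 F K) => (1 : ℝ))).symm g = toL2 F K 1 Jv := by
    apply (toL2 F K (1 : ℝ)).symm.injective
    rw [LinearEquiv.symm_apply_apply]
    funext bd
    rw [toL2_symm_funEquiv_symm_apply]
  have hJv : ∀ bd, ‖Jv bd‖ ≤ ρ := fun bd => (norm_negSup_equiv_apply_le _ _).trans hJ
  rw [actionGrad_eq_inner_toL2_Jcur (n := n) (c₀ := (1 : ℝ)) U₀ Z, ← hgdef, hJhat, inner_toL2, norm_mul]
  have hcoef : ‖-(I * ((((F.L : ℝ)⁻¹) ^ (K - n) : ℝ) : ℂ) ^ 3 / (2 * ((1 : ℝ) : ℂ)))‖ = (((F.L : ℝ)⁻¹) ^ (K - n)) ^ 3 / (2 * 1) := by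
    rw [norm_neg, norm_div, norm_mul, Complex.norm_I, one_mul, norm_pow, Complex.norm_real, Real.norm_of_nonneg hηpos.le, norm_mul, Complex.norm_real,
      Real.norm_of_nonneg hc₀.le, Complex.norm_ofNat]
  rw [hcoef]
  have hsum : ‖((1 : ℝ) : ℂ) * ∑ b : PBond (F.P K) 0, Matrix.trace (((star Z) b).conjTranspose * Jv b)‖ ≤ 1 * (2 * ρ * ∑ b : PBond (F.P K) 0, ‖Z b‖) := by
    rw [norm_mul, Complex.norm_real, Real.norm_of_nonneg hc₀.le]
    refine mul_le_mul_of_nonneg_left ?_ hc₀.le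
    calc ‖∑ b : PBond (F.P K) 0, Matrix.trace (((star Z) b).conjTranspose * Jv b)‖
        ≤ ∑ b : PBond (F.P K) 0, ‖Matrix.trace (((star Z) b).conjTranspose * Jv b)‖ := norm_sum_le _ _
      _ ≤ ∑ b : PBond (F.P K) 0, 2 * (‖Z b‖ * ρ) := Finset.sum_le_sum fun b _ => by
          rw [Pi.star_apply, Matrix.star_eq_conjTranspose, Matrix.conjTranspose_conjTranspose]
          exact (norm_trace_mul_le _ _).trans (mul_le_mul_of_nonneg_left (mul_le_mul_of_nonneg_left (hJv b) (norm_nonneg _)) (by norm_num))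
      _ = 2 * ρ * ∑ b : PBond (F.P K) 0, ‖Z b‖ := by rw [Finset.mul_sum]; exact Finset.sum_congr rfl fun b _ => by ring
  calc (((F.L : ℝ)⁻¹) ^ (K - n)) ^ 3 / (2 * 1) * ‖((1 : ℝ) : ℂ) * ∑ b : PBond (F.P K) 0, Matrix.trace (((star Z) b).conjTranspose * Jv b)‖
      ≤ (((F.L : ℝ)⁻¹) ^ (K - n)) ^ 3 / (2 * 1) * (1 * (2 * ρ * ∑ b : PBond (F.P K) 0, ‖Z b‖)) := mul_le_mul_of_nonneg_left hsum (by positivity)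
    _ = (((F.L : ℝ)⁻¹) ^ (K - n)) ^ 3 * ρ * ∑ b : PBond (F.P K) 0, ‖Z b‖ := by ring

/-- **`H46P` READ THROUGH `flat115 ∘ H1f`**: `H46P U₀ B bd = η • flat115 (H1f … Δ_πᴾ U₀ B) (bondEquiv bd)` — print's `H` (3.126) on the route carrier (`Hf = η•toL2⁻¹∘HT∘toL2B`, ✓`Hf_apply`)
and in the (115)-reader (`H1f`, ✓`H1f_apply`) are the SAME Hilbert-level `HT`. [cite: Balaban1985BackgroundPropagators, (3.126) p.420; Balaban1985Variational, (45) p.285, (103) p.293, (115) p.294] -/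
theorem H46P_apply_eq_smul_flat115 [Fact (0 < (F.L : ℝ))] [Fact (0 < ((F.L : ℝ)⁻¹) ^ (K - n))]
    (U₀ : GaugeField (F.P K) 0 (Matrix.specialUnitaryGroup (Fin 2) ℂ)) (B : PBond (F.P n) 0 → Matrix (Fin 2) (Fin 2) ℂ) (bd : PBond (F.P K) 0) :
    H46P F n K h c₀ cB a U₀ B bd
      = (((eta F n K : ℝ) : ℂ)) • flat115 (H1f F n K h c₀ cB a (DeltaPiSlotP F n K h c₀ cB a) U₀ B) (bondEquiv F K bd) := by
  rw [H46P, Hf_apply, Pi.smul_apply, toL2_symm_apply, flat115_apply, H1f_apply]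

/-- ★ **(H) FROM AN `hHcol`-SHAPED COLUMN MAJORANT**: if `‖flat115 (H1f … Δ_πᴾ U₀ (δ_y·Z)) b′‖ ≤ hk b′ y·‖Z‖` with `Σ_{b′} hk b′ y ≤ Θ` for every block bond `y`, then
`Σ_bd ‖H46P U₀ B bd‖ ≤ η·Θ·Σ_y ‖B y‖` for EVERY block field `B` (linearity `B = Σ_y δ_y·B(y)`, the triangle inequality, and the bond reindexing `bondEquiv`).
[cite: Balaban1985BackgroundPropagators, (3.126) p.420, (3.133) p.422; Balaban1985Variational, (115) p.294] -/
theorem sum_norm_H46P_le_of_column [Fact (0 < (F.L : ℝ))] [Fact (0 < ((F.L : ℝ)⁻¹) ^ (K - n))]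
    (U₀ : GaugeField (F.P K) 0 (Matrix.specialUnitaryGroup (Fin 2) ℂ)) {hk : Bond 3 (periodsT3 F K) → PBond (F.P n) 0 → ℝ} {Θ : ℝ}
    (hcol : ∀ (y : PBond (F.P n) 0) (Z : Matrix (Fin 2) (Fin 2) ℂ) (b' : Bond 3 (periodsT3 F K)),
      ‖flat115 (H1f F n K h c₀ cB a (DeltaPiSlotP F n K h c₀ cB a) U₀ (Pi.single y Z)) b'‖ ≤ hk b' y * ‖Z‖)
    (hsum : ∀ y : PBond (F.P n) 0, ∑ b' : Bond 3 (periodsT3 F K), hk b' y ≤ Θ)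
    (B : PBond (F.P n) 0 → Matrix (Fin 2) (Fin 2) ℂ) :
    ∑ bd : PBond (F.P K) 0, ‖H46P F n K h c₀ cB a U₀ B bd‖ ≤ eta F n K * Θ * ∑ y : PBond (F.P n) 0, ‖B y‖ := by
  have hη : 0 < eta F n K := eta_pos F n K
  set Hc := H1f F n K h c₀ cB a (DeltaPiSlotP F n K h c₀ cB a) U₀ with hHc
  -- pointwise column bound for a general `B`
  have hpt : ∀ b' : Bond 3 (periodsT3 F K), ‖flat115 (Hc B) b'‖ ≤ ∑ y : PBond (F.P n) 0, hk b' y * ‖B y‖ := by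
    intro b'
    have hB : B = ∑ y : PBond (F.P n) 0, Pi.single y (B y) := (Finset.univ_sum_single B).symm
    calc ‖flat115 (Hc B) b'‖ = ‖∑ y : PBond (F.P n) 0, flat115 (Hc (Pi.single y (B y))) b'‖ := by
            conv_lhs => rw [hB]
            rw [map_sum, map_sum, Finset.sum_apply]
      _ ≤ ∑ y : PBond (F.P n) 0, ‖flat115 (Hc (Pi.single y (B y))) b'‖ := norm_sum_le _ _
      _ ≤ ∑ y : PBond (F.P n) 0, hk b' y * ‖B y‖ := Finset.sum_le_sum fun y _ => hcol y (B y) b'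
  -- reindex the fine bonds and sum the columns
  have hre : ∑ bd : PBond (F.P K) 0, ‖H46P F n K h c₀ cB a U₀ B bd‖ = eta F n K * ∑ b' : Bond 3 (periodsT3 F K), ‖flat115 (Hc B) b'‖ := by
    rw [Finset.mul_sum, ← (bondEquiv F K).sum_comp]
    refine Finset.sum_congr rfl fun bd _ => ?_
    rw [H46P_apply_eq_smul_flat115, norm_smul, Complex.norm_real, Real.norm_of_nonneg hη.le]
  rw [hre, mul_assoc]
  refine mul_le_mul_of_nonneg_left ?_ hη.le
  calc ∑ b' : Bond 3 (periodsT3 F K), ‖flat115 (Hc B) b'‖ ≤ ∑ b' : Bond 3 (periodsT3 F K), ∑ y : PBond (F.P n) 0, hk b' y * ‖B y‖ := Finset.sum_le_sum fun b' _ => hpt b'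
    _ = ∑ y : PBond (F.P n) 0, (∑ b' : Bond 3 (periodsT3 F K), hk b' y) * ‖B y‖ := by rw [Finset.sum_comm]; exact Finset.sum_congr rfl fun y _ => by rw [Finset.sum_mul]
    _ ≤ ∑ y : PBond (F.P n) 0, Θ * ‖B y‖ := Finset.sum_le_sum fun y _ => mul_le_mul_of_nonneg_right (hsum y) (norm_nonneg _)
    _ = Θ * ∑ y : PBond (F.P n) 0, ‖B y‖ := by rw [Finset.mul_sum]

/-! ## §2 The member door: the sup-row of `T_Jᴾ(U₀)` from (J)(H)(q) by duality -/

/-- ★★ **THE SUP-ROW OF `T_Jᴾ(U₀)` FROM THE THREE COLUMN ROWS** (J) `‖actionGrad U₀ Z‖ ≤ cJ·Σ_b‖Z b‖`, (H) `Σ_b‖H46P U₀ B b‖ ≤ θ·Σ_y‖B y‖`, (q) `Σ_y‖avgHess U₀ X′ (δ_bd·E) y‖ ≤ q·s′·‖E‖`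
(`sup‖X′‖ ≤ s′`): **`‖(toL2⁻¹ T_Jᴾ(U₀) toL2 X) bd‖ ≤ (2∕η²)·cJ·θ·q·s`** whenever `sup_b‖X b‖ ≤ s` — by testing `⟪T_Jᴾ toL2 X, toL2(δ_bd·A)⟫ = (2c₀∕η²)·actionGrad(H46P(avgHess Xᴴ (δ_bd·A)))`
at `A := (toL2⁻¹ T_Jᴾ toL2 X) bd` and `c₀‖A‖² ≤ ‖toL2(δ_bd·A)‖²`. [cite: Balaban1985BackgroundPropagators, (3.127)–(3.128) p.421, (3.137) p.423, (3.11) p.392] -/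
theorem norm_TJP_apply_le_of_columns (U₀ : GaugeField (F.P K) 0 (Matrix.specialUnitaryGroup (Fin 2) ℂ)) {cJ θ q s : ℝ} (hcJ : 0 ≤ cJ) (hθ : 0 ≤ θ) (hq : 0 ≤ q) (hs : 0 ≤ s)
    (hJ : ∀ Z : PBond (F.P K) 0 → Matrix (Fin 2) (Fin 2) ℂ, ‖actionGrad F K U₀ Z‖ ≤ cJ * ∑ b : PBond (F.P K) 0, ‖Z b‖)
    (hH : ∀ B : PBond (F.P n) 0 → Matrix (Fin 2) (Fin 2) ℂ, ∑ bd : PBond (F.P K) 0, ‖H46P F n K h c₀ cB a U₀ B bd‖ ≤ θ * ∑ y : PBond (F.P n) 0, ‖B y‖)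
    (hQ : ∀ (X' : PBond (F.P K) 0 → Matrix (Fin 2) (Fin 2) ℂ) (s' : ℝ) (bd : PBond (F.P K) 0) (E : Matrix (Fin 2) (Fin 2) ℂ), (∀ b, ‖X' b‖ ≤ s') →
      ∑ y : PBond (F.P n) 0, ‖avgHess F n K h U₀ X' (Pi.single bd E) y‖ ≤ q * s' * ‖E‖)
    (X : PBond (F.P K) 0 → Matrix (Fin 2) (Fin 2) ℂ) (hX : ∀ b, ‖X b‖ ≤ s) (bd : PBond (F.P K) 0) :
    ‖(toL2 F K c₀).symm (TJP F n K h c₀ cB a U₀ (toL2 F K c₀ X)) bd‖ ≤ 2 / (eta F n K) ^ 2 * cJ * θ * q * s := by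
  have hc₀ : (0 : ℝ) < c₀ := Fact.out
  have hη : 0 < eta F n K := eta_pos F n K
  set Y : PBond (F.P K) 0 → Matrix (Fin 2) (Fin 2) ℂ := (toL2 F K c₀).symm (TJP F n K h c₀ cB a U₀ (toL2 F K c₀ X)) with hYdef
  set A : Matrix (Fin 2) (Fin 2) ℂ := Y bd with hAdef
  set w : BondL2K ℂ 3 (periodsT3 F K) c₀ W₂ := toL2 F K c₀ (Pi.single bd A) with hwdef
  -- (1) `⟪toL2 Y, w⟫ = ⟪w, w⟫`
  have h1 : ⟪toL2 F K c₀ Y, w⟫_ℂ = ⟪w, w⟫_ℂ := by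
    rw [hwdef, inner_toL2, inner_toL2]
    refine congrArg (fun z : ℂ => (c₀ : ℂ) * z) (Finset.sum_congr rfl fun b _ => ?_)
    by_cases hb : b = bd
    · subst hb; rw [Pi.single_eq_same]
    · rw [Pi.single_eq_of_ne hb, Matrix.mul_zero, Matrix.conjTranspose_zero, Matrix.zero_mul]
  -- (2) `toL2 Y = T_Jᴾ (toL2 X)`
  have h2 : toL2 F K c₀ Y = TJP F n K h c₀ cB a U₀ (toL2 F K c₀ X) := by rw [hYdef, LinearEquiv.apply_symm_apply]
  -- (3) the pairing through the J-term formula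
  have h3 : ⟪toL2 F K c₀ Y, w⟫_ℂ = ((-(2 * (c₀ : ℂ))) / (((eta F n K : ℝ) : ℂ)) ^ 2) *
      -actionGrad F K U₀ (H46P F n K h c₀ cB a U₀ (avgHess F n K h U₀ (star X) (Pi.single bd A))) := by
    rw [h2, inner_TJP_left, tjSesqP_apply, tjFormP_apply, hwdef, LinearEquiv.symm_apply_apply, LinearEquiv.symm_apply_apply]
  -- (4) the upper bound of the pairing from (J)(H)(q)
  have hX' : ∀ b, ‖(star X) b‖ ≤ s := norm_star_apply_le hX
  have h4 : ‖⟪toL2 F K c₀ Y, w⟫_ℂ‖ ≤ 2 * c₀ / (eta F n K) ^ 2 * (cJ * (θ * (q * s * ‖A‖))) := by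
    rw [h3, norm_mul, norm_neg]
    have hcoef : ‖(-(2 * (c₀ : ℂ))) / (((eta F n K : ℝ) : ℂ)) ^ 2‖ = 2 * c₀ / (eta F n K) ^ 2 := by
      rw [norm_div, norm_neg, norm_mul, norm_pow, Complex.norm_real, Complex.norm_real, Real.norm_of_nonneg hc₀.le, Real.norm_of_nonneg hη.le, Complex.norm_ofNat]
    rw [hcoef]
    refine mul_le_mul_of_nonneg_left ?_ (by positivity)
    calc ‖actionGrad F K U₀ (H46P F n K h c₀ cB a U₀ (avgHess F n K h U₀ (star X) (Pi.single bd A)))‖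
        ≤ cJ * ∑ b : PBond (F.P K) 0, ‖H46P F n K h c₀ cB a U₀ (avgHess F n K h U₀ (star X) (Pi.single bd A)) b‖ := hJ _
      _ ≤ cJ * (θ * ∑ y : PBond (F.P n) 0, ‖avgHess F n K h U₀ (star X) (Pi.single bd A) y‖) := mul_le_mul_of_nonneg_left (hH _) hcJ
      _ ≤ cJ * (θ * (q * s * ‖A‖)) := mul_le_mul_of_nonneg_left (mul_le_mul_of_nonneg_left (hQ (star X) s bd A hX') hθ) hcJ
  -- (5) the lower bound `c₀‖A‖² ≤ ‖w‖² = ‖⟪toL2 Y, w⟫‖`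
  have h5 : c₀ * ‖A‖ ^ 2 ≤ ‖w‖ ^ 2 := by
    have hc := c0_mul_sum_norm_sq_le_norm_sq_toL2 F K c₀ (Pi.single bd A)
    rw [Finset.sum_eq_single bd (fun b _ hb => by rw [Pi.single_eq_of_ne hb, norm_zero, zero_pow two_ne_zero])
      (fun hbd => (hbd (Finset.mem_univ bd)).elim), Pi.single_eq_same] at hc
    rwa [hwdef]
  have h6 : ‖⟪toL2 F K c₀ Y, w⟫_ℂ‖ = ‖w‖ ^ 2 := by
    rw [h1, inner_self_eq_norm_sq_to_K, norm_pow, RCLike.norm_ofReal, abs_norm]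
  have h7 : c₀ * ‖A‖ ^ 2 ≤ 2 * c₀ / (eta F n K) ^ 2 * (cJ * (θ * (q * s * ‖A‖))) := h5.trans (h6 ▸ h4)
  -- (6) divide by `c₀‖A‖`
  have hK : 0 ≤ 2 / (eta F n K) ^ 2 * cJ * θ * q * s := by positivity
  by_cases hA0 : ‖A‖ = 0
  · rw [hA0]; exact hK
  · have hApos : 0 < ‖A‖ := lt_of_le_of_ne (norm_nonneg _) (Ne.symm hA0)
    have h8 : ‖A‖ * (c₀ * ‖A‖) ≤ (2 / (eta F n K) ^ 2 * cJ * θ * q * s) * (c₀ * ‖A‖) := by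
      calc ‖A‖ * (c₀ * ‖A‖) = c₀ * ‖A‖ ^ 2 := by ring
        _ ≤ 2 * c₀ / (eta F n K) ^ 2 * (cJ * (θ * (q * s * ‖A‖))) := h7
        _ = (2 / (eta F n K) ^ 2 * cJ * θ * q * s) * (c₀ * ‖A‖) := by ring
    exact le_of_mul_le_mul_right h8 (by positivity)


/-- ★★ **THE MEMBER DOOR AT `U₀ ∈ 𝔘_k(ρ)`**: from an `hHcol`-shaped column majorant (`hcol`, `hsum` with total `Θ`) and the local Hessian column row (q) (constant `q`), the sup-row of the
J-term slot `TJSlotP` holds with constant `2·ρ·Θ·q·η²` — (J) is supplied by ✓`norm_actionGrad_le_of_regPr` (`cJ := η³ρ`), (H) by ✓`sum_norm_H46P_le_of_column` (`θ := η·Θ`).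
[cite: Balaban1985BackgroundPropagators, (3.127)–(3.128) p.421, (3.137) p.423, (3.126) p.420; Balaban1985Variational, (28) p.282] -/
theorem tjRow_of_regPr_column [Fact (0 < (F.L : ℝ))] [Fact (0 < ((F.L : ℝ)⁻¹) ^ (K - n))] {ρ Θ q : ℝ} (hρ : 0 ≤ ρ) (hΘ : 0 ≤ Θ) (hq : 0 ≤ q)
    (U₀ : GaugeField (F.P K) 0 (Matrix.specialUnitaryGroup (Fin 2) ℂ)) (hreg : RegPr F n K ρ U₀)
    {hk : Bond 3 (periodsT3 F K) → PBond (F.P n) 0 → ℝ}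
    (hcol : ∀ (y : PBond (F.P n) 0) (Z : Matrix (Fin 2) (Fin 2) ℂ) (b' : Bond 3 (periodsT3 F K)),
      ‖flat115 (H1f F n K h c₀ cB a (DeltaPiSlotP F n K h c₀ cB a) U₀ (Pi.single y Z)) b'‖ ≤ hk b' y * ‖Z‖)
    (hsum : ∀ y : PBond (F.P n) 0, ∑ b' : Bond 3 (periodsT3 F K), hk b' y ≤ Θ)
    (hQ : ∀ (X' : PBond (F.P K) 0 → Matrix (Fin 2) (Fin 2) ℂ) (s' : ℝ) (bd : PBond (F.P K) 0) (E : Matrix (Fin 2) (Fin 2) ℂ), (∀ b, ‖X' b‖ ≤ s') →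
      ∑ y : PBond (F.P n) 0, ‖avgHess F n K h U₀ X' (Pi.single bd E) y‖ ≤ q * s' * ‖E‖) :
    ∀ (X : PBond (F.P K) 0 → Matrix (Fin 2) (Fin 2) ℂ) (s : ℝ), (∀ bd, ‖X bd‖ ≤ s) →
      ∀ bd : PBond (F.P K) 0, ‖(toL2 F K c₀).symm (TJSlotP F n K h c₀ cB a U₀ (toL2 F K c₀ X)) bd‖ ≤ 2 * ρ * Θ * q * (eta F n K) ^ 2 * s := by
  intro X s hX bd
  have hη : 0 < eta F n K := eta_pos F n K
  have hs : 0 ≤ s := (norm_nonneg _).trans (hX bd)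
  have hJ := norm_actionGrad_le_of_regPr (F := F) (n := n) (K := K) hρ U₀ hreg
  have hH := sum_norm_H46P_le_of_column (h := h) (c₀ := c₀) (cB := cB) (a := a) U₀ hcol hsum
  have hmain := norm_TJP_apply_le_of_columns (h := h) (c₀ := c₀) (cB := cB) (a := a) U₀ (cJ := (((F.L : ℝ)⁻¹) ^ (K - n)) ^ 3 * ρ) (θ := eta F n K * Θ)
    (by positivity) (by positivity) hq hs hJ hH hQ X hX bd
  rw [TJSlotP_apply]
  calc ‖(toL2 F K c₀).symm (TJP F n K h c₀ cB a U₀ (toL2 F K c₀ X)) bd‖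
      ≤ 2 / (eta F n K) ^ 2 * ((((F.L : ℝ)⁻¹) ^ (K - n)) ^ 3 * ρ) * (eta F n K * Θ) * q * s := hmain
    _ = 2 * ρ * Θ * q * (eta F n K) ^ 2 * s := by
        have hdef : eta F n K = ((F.L : ℝ)⁻¹) ^ (K - n) := rfl
        rw [← hdef]
        field_simp

/-! ## §3 The family door: S19ᴸ's `hTJ` from S19ᴸ's `hHcol` and ONE displayed local-Hessian row `hq` -/

/-- ★★★ **THE FAMILY DOOR `hTJ ⟸ hHcol ∧ hq`** — the EX display's operator row `hTJ` (S19ᴸ ✓p688733 :213–215, the sup-row of print's `T_Jᴾ`, [Balaban1985BackgroundPropagators] (3.137)) TOKEN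
FOR TOKEN with `kTJ L := 2·α L·ΘH L·qA L`, from the display's column row `hHcol` VERBATIM (the `ℓ¹`-column of print's `H` (3.126), [B9] Thm 3.12 (3.133) class, N06) and ONE row in
supplier currency, `hq`: the LOCAL column of the averaging Hessian `2C⁽²⁾(U₀) = avgHess U₀` against a one-bond datum, `Σ_y ‖avgHess U₀ X′ (δ_bd·E) y‖ ≤ qA·(L^{K−n})⁻¹·sup‖X′‖·‖E‖`
((3.14)'s `C_j` is local and begins with second-order terms; [Balaban1985Averaging] (157) class).  The current row (28) is discharged inside (✓`norm_actionGrad_le_of_regPr`).  Dimension line: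
`(2∕η²)·(η³α)·(η·ΘH·(L^{K−n})³)·(qA·(L^{K−n})⁻¹) = 2·α·ΘH·qA` since `L^{K−n}·η = 1`.  CONDITIONAL door; nothing of the stub is claimed.
[cite: Balaban1985BackgroundPropagators, (3.137) p.423, (3.127)–(3.128) p.421, (3.126) p.420, (3.133) p.422, (3.14) p.393; Balaban1985Variational, (27)–(28) p.282; Balaban1985Averaging, (157) p.42] -/
theorem hTJ_of_hHcol_hq
    [hFL : ∀ F : T3Family, Fact (0 < (F.L : ℝ))] [hFη : ∀ (F : T3Family) (k : ℕ), Fact (0 < ((F.L : ℝ)⁻¹) ^ k)]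
    (α ΘH qA : ℕ → ℝ) (hα : ∀ L, 1 < L → 0 < α L) (hΘH0 : ∀ L, 1 < L → 0 ≤ ΘH L) (hqA0 : ∀ L, 1 < L → 0 ≤ qA L)
    (c₀ cB : ℕ → ℝ) [hc₀ : ∀ L : ℕ, Fact (0 < c₀ L)] [hcB : ∀ L : ℕ, Fact (0 < cB L)]
    (a : ∀ L : ℕ, Idx L → ℝ)
    (hHcol : ∀ (L : ℕ), 1 < L → ∀ (i : Idx L) (U₀ : GaugeField (i.1.1.P i.1.2.2) 0 (Matrix.specialUnitaryGroup (Fin 2) ℂ)), RegPr i.1.1 i.1.2.1 i.1.2.2 (α L) U₀ →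
      ∃ hk : Bond 3 (periodsT3 i.1.1 i.1.2.2) → PBond (i.1.1.P i.1.2.1) 0 → ℝ, (∀ b' y, 0 ≤ hk b' y) ∧
        (∀ (y : PBond (i.1.1.P i.1.2.1) 0) (Z : Matrix (Fin 2) (Fin 2) ℂ) (b' : Bond 3 (periodsT3 i.1.1 i.1.2.2)), ‖flat115 ((H1f i.1.1 i.1.2.1 i.1.2.2 i.2.2.le (c₀ L) (cB L) (a L i) (DeltaPiSlotP i.1.1 i.1.2.1 i.1.2.2 i.2.2.le (c₀ L) (cB L) (a L i)) U₀) (Pi.single y Z)) b'‖ ≤ hk b' y * ‖Z‖) ∧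
        (∀ y : PBond (i.1.1.P i.1.2.1) 0, ∑ b' : Bond 3 (periodsT3 i.1.1 i.1.2.2), hk b' y ≤ ΘH L * ((L : ℝ) ^ (i.1.2.2 - i.1.2.1)) ^ 3))
    -- ROW `hq` — THE LOCAL COLUMN OF THE AVERAGING HESSIAN `2C⁽²⁾(U₀)` AGAINST A ONE-BOND DATUM (supplier currency `qA·(L^{K−n})⁻¹`; DISPLAYED; at `U₀ = 1` a finite flat computation)
    (hq : ∀ (L : ℕ), 1 < L → ∀ (i : Idx L) (U₀ : GaugeField (i.1.1.P i.1.2.2) 0 (Matrix.specialUnitaryGroup (Fin 2) ℂ)), RegPr i.1.1 i.1.2.1 i.1.2.2 (α L) U₀ →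
      ∀ (X' : PBond (i.1.1.P i.1.2.2) 0 → Matrix (Fin 2) (Fin 2) ℂ) (s : ℝ) (bd : PBond (i.1.1.P i.1.2.2) 0) (E : Matrix (Fin 2) (Fin 2) ℂ), (∀ b, ‖X' b‖ ≤ s) →
        ∑ y : PBond (i.1.1.P i.1.2.1) 0, ‖avgHess i.1.1 i.1.2.1 i.1.2.2 i.2.2.le U₀ X' (Pi.single bd E) y‖ ≤ qA L * ((L : ℝ) ^ (i.1.2.2 - i.1.2.1))⁻¹ * s * ‖E‖) :
    ∀ (L : ℕ), 1 < L → ∀ (i : Idx L) (U₀ : GaugeField (i.1.1.P i.1.2.2) 0 (Matrix.specialUnitaryGroup (Fin 2) ℂ)), RegPr i.1.1 i.1.2.1 i.1.2.2 (α L) U₀ →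
      ∀ (X : PBond (i.1.1.P i.1.2.2) 0 → Matrix (Fin 2) (Fin 2) ℂ) (s : ℝ), (∀ bd, ‖X bd‖ ≤ s) →
        ∀ bd : PBond (i.1.1.P i.1.2.2) 0, ‖(toL2 i.1.1 i.1.2.2 (c₀ L)).symm (TJSlotP i.1.1 i.1.2.1 i.1.2.2 i.2.2.le (c₀ L) (cB L) (a L i) U₀ (toL2 i.1.1 i.1.2.2 (c₀ L) X)) bd‖ ≤
          2 * α L * ΘH L * qA L * s := by
  intro L hL i U₀ hU X s hX bd
  obtain ⟨hk, -, hcol, hsum⟩ := hHcol L hL i U₀ hU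
  have hLpos : (0 : ℝ) < L := by exact_mod_cast (zero_lt_one.trans hL)
  have hM : (0 : ℝ) < (L : ℝ) ^ (i.1.2.2 - i.1.2.1) := pow_pos hLpos _
  have hs : 0 ≤ s := (norm_nonneg _).trans (hX bd)
  have hΘ := hΘH0 L hL
  have hqA := hqA0 L hL
  have hrow := tjRow_of_regPr_column (h := i.2.2.le) (c₀ := c₀ L) (cB := cB L) (a := a L i) (hα L hL).le (by positivity : 0 ≤ ΘH L * ((L : ℝ) ^ (i.1.2.2 - i.1.2.1)) ^ 3)
    (by positivity : 0 ≤ qA L * ((L : ℝ) ^ (i.1.2.2 - i.1.2.1))⁻¹) U₀ hU hcol hsum (hq L hL i U₀ hU) X s hX bd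
  have hη : eta i.1.1 i.1.2.1 i.1.2.2 = ((L : ℝ) ^ (i.1.2.2 - i.1.2.1))⁻¹ := by
    have hLi : (i.1.1.L : ℝ) = (L : ℝ) := by exact_mod_cast i.2.1
    show ((i.1.1.L : ℝ)⁻¹) ^ (i.1.2.2 - i.1.2.1) = _
    rw [hLi, inv_pow]
  rw [hη] at hrow
  calc ‖(toL2 i.1.1 i.1.2.2 (c₀ L)).symm (TJSlotP i.1.1 i.1.2.1 i.1.2.2 i.2.2.le (c₀ L) (cB L) (a L i) U₀ (toL2 i.1.1 i.1.2.2 (c₀ L) X)) bd‖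
      ≤ 2 * α L * (ΘH L * ((L : ℝ) ^ (i.1.2.2 - i.1.2.1)) ^ 3) * (qA L * ((L : ℝ) ^ (i.1.2.2 - i.1.2.1))⁻¹) * (((L : ℝ) ^ (i.1.2.2 - i.1.2.1))⁻¹) ^ 2 * s := hrow
    _ = 2 * α L * ΘH L * qA L * s := by field_simp


end Summit.QuantumFields.YangMills.Theorems.Prop7TJRowOfColumns

end
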